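import Summits.QuantumFields.BalabanUV.T4Continuum.Support.AveragingDeficitChartCalculus
import HarnessLib

/-!
# T⁴ programme, node NE3, row S6-Y7 (P3 leaf L7 «SLOP», k-level input (K1)) — THE LINEARISATION OF BAŁABAN'S AVERAGE IS
# GAUGE-COVARIANT: `pushDir L W (gaugeDir W λ) (L·y, κ) = gaugeDir (cavg L W) (λ ∘ L·) (y, κ)` (`BlockAveragePushDirGauge`)

Cell `pub-balaban`, NE3 formalisation swarm (`t4/formal/NE3/LEAVES.md` row S5∕S6, sub-row S6-Y7; unit
`b2b-balaban-t4-ne3-formalise-leaf-10`, gen 2).  The k-level form of road P3's L7(a) (SHAPE `Statements/S6-Y7-SHAPE-v1.md` §2)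
needs the propagation of directions through the linearised one-step averages `P_W = pushDir L W` (row NE3-R2's
`AveragingDeficitResidualPairing.pushDir`, the differential `D coord(0)` of `AveragingDeficitChartCalculus.fderiv_coord_apply`).
Its first structural input is the EXACT COVARIANCE of `P_W` on infinitesimal gauge directions — the derivative of B7's (45)
«`\bar{V^u}_c = u(c₋) V̄_c u(c₊)⁻¹`» (tree `B7Prop1Explicit.bavg_gaugeAct`) along the one-parameter gauge group `u_t = e^{tλ}`:
in the right exponential chart `Y ↦ W·e^{Y}` the gauge orbit through `W` has tangent
`gaugeDir W λ (x, μ) = Ad_{W(x,μ)⁻¹} λ(x) − λ(x + e_μ)`, and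

  `pushDir L W (gaugeDir W λ) (L·q, κ) = Ad_{(cavg L W)(q,κ)⁻¹} λ(L·q) − λ(L·q + L·e_κ) = gaugeDir (cavg L W) (λ ∘ (L·)) (q, κ)`

for a periodic `U(N)`-valued small-field `W`, a periodic `𝔲(N)`-valued `λ` and the torus representatives `q = boxVec M r`
(`pushDir_gaugeDir`).  Consequence for the k-level plan: gauge components of a direction are NOT amplified by the linearised
average — they are evaluated at the surviving coarse sites (the located point of SHAPE v1 §2: only the frame∕gauge part of
the plain linearisation fails to contract in `ℓ¹`).  Method: §1 the pointwise derivative of the relative logarithm of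
`W^{u_t}` is `gaugeDir` (`hasDerivAt_exp_smul_zero`, `hasFDerivAt_mlog_one`); §2 periodicity; §3 on the finite torus the curve
`t ↦ resDir (log(W⁻¹W^{u_t}))` in the chart parameter space `TDir` represents `W^{u_t}` near `t = 0` (`exp_mlog`), so the chain
rule through `coord` (`contDiffAt_coord`, `fderiv_coord_apply` BY NAME) computes the derivative of
`t ↦ log(V̄(c)⁻¹·\overline{W^{u_t}}(c))` once as `pushDir L W (gaugeDir W λ)` and once, through (45), as the coarse gauge
direction; real derivatives are unique.

HONEST FRAMING: finite-`T⁴` kinematics of ONE block-averaging step on ONE lattice (rung (B)+1 — NOT infinite volume, NOT a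
mass gap, NOT Clay); an exact identity, no estimate; nothing of NE3 is claimed (NE3-E stays CONDITIONAL on the co-owners'
⟨named structures⟩; the k-level L7(a) stays OPEN); no `BetaPertH`, no (B), no G-an2-4; no printed sentence is a hypothesis
([cite:] tags are context).  PLACEMENT (human rule 2026-08-19): our work, under `Summits/QuantumFields/BalabanUV/`.
-/

set_option autoImplicit false

open scoped BigOperators Matrix.Norms.L2Operator Topology
open NormedSpace Finset Filter Metric

namespace Summit.QuantumFields.BalabanUV.T4Continuum.BlockAveragePushDirGauge

open Literature.MathematicalPhysics.QuantumFieldTheory.Balaban1983to89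
open B7Prop1Explicit B7Prop2Explicit MatrixLog UnitaryModel
open T4AveragingDeficitWall hiding Site Plane Plaq Bond
open T4AveragingDeficitWallBoundary (IsPeriodicCfg)
open AveragingDeficitPeriodicCounting (IsPeriodicDir)
open AveragingDeficitResidualPairing (pushDir)
open AveragingDeficitTorusChart AveragingDeficitChartCalculus

noncomputable section

variable {d : ℕ} {n : Type*} [Fintype n] [DecidableEq n]

/-! ## §1 The infinitesimal gauge direction in the right exponential chart -/

/-- THE TANGENT OF THE GAUGE ORBIT through `W` in the chart `Y ↦ W·e^{Y}`:
`gaugeDir W λ (x, μ) = Ad_{W(x,μ)⁻¹} λ(x) − λ(x + e_μ)` (`d/dt|₀ log(W(b)⁻¹·e^{tλ(x)} W(b) e^{−tλ(x+e_μ)})`). [folklore] -/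
def gaugeDir (W : Site d → Fin d → (Matrix n n ℂ)ˣ) (lam : Site d → Matrix n n ℂ) : Site d → Fin d → Matrix n n ℂ :=
  fun x μ => Ad (W x μ)⁻¹ (lam x) - lam (x + e μ)

/-- The one-parameter gauge group `u_t(x) = e^{tλ(x)}` generated by a site field `λ`. [folklore] -/
def expGauge (lam : Site d → Matrix n n ℂ) (t : ℝ) : Site d → (Matrix n n ℂ)ˣ := fun x => expUnit ((t : ℂ) • lam x)

/-- The relative logarithm `log(W(b)⁻¹ · W^{u_t}(b))` of the gauge-transformed configuration, bond by bond. [folklore] -/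
def gaugeRelLog (W : Site d → Fin d → (Matrix n n ℂ)ˣ) (lam : Site d → Matrix n n ℂ) (t : ℝ) :
    Site d → Fin d → Matrix n n ℂ :=
  fun x μ => mlog ((((W x μ)⁻¹ : (Matrix n n ℂ)ˣ) : Matrix n n ℂ) * ((gaugeAct (expGauge lam t) W x μ : (Matrix n n ℂ)ˣ) : Matrix n n ℂ))

/-- `u_0 = 1`. [folklore] -/
@[simp] theorem expGauge_zero (lam : Site d → Matrix n n ℂ) : expGauge lam 0 = fun _ => 1 := by
  funext x; ext; simp [expGauge]

/-- The trivial gauge transformation acts trivially. [folklore] -/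
theorem gaugeAct_const_one (W : Site d → Fin d → (Matrix n n ℂ)ˣ) :
    gaugeAct (fun _ : Site d => (1 : (Matrix n n ℂ)ˣ)) W = W := by
  funext x μ; simp [gaugeAct]

/-- At `t = 0` the relative logarithm vanishes. [folklore] -/
@[simp] theorem gaugeRelLog_zero (W : Site d → Fin d → (Matrix n n ℂ)ˣ) (lam : Site d → Matrix n n ℂ) :
    gaugeRelLog W lam 0 = fun _ _ => 0 := by
  funext x μ
  simp [gaugeRelLog, gaugeAct_const_one, MatrixLog.mlog_one]

/-- `e^{tλ(x)}` is unitary for skew `λ(x)`, hence in `{‖u‖ ≤ 1, ‖u⁻¹‖ ≤ 1}`. [folklore] -/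
theorem expGauge_mem_U1 [Nonempty n] {lam : Site d → Matrix n n ℂ} (hlam : ∀ x, lam x ∈ skewAdjoint (Matrix n n ℂ))
    (t : ℝ) (x : Site d) : expGauge lam t x ∈ U1 (Matrix n n ℂ) := by
  letI : NormedAlgebra ℚ (Matrix n n ℂ) := NormedAlgebra.restrictScalars ℚ ℝ (Matrix n n ℂ)
  have hskew : (t : ℂ) • lam x ∈ skewAdjoint (Matrix n n ℂ) := by
    rw [Complex.coe_smul]
    exact skewAdjoint.smul_mem t (hlam x)
  have hu : expGauge lam t x ∈ unitaryUnits (Matrix n n ℂ) := by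
    rw [mem_unitaryUnits]
    exact NormedSpace.exp_mem_unitary_of_mem_skewAdjoint hskew
  exact ⟨(CStarRing.norm_of_mem_unitary hu).le,
    (CStarRing.norm_of_mem_unitary ((unitaryUnits (Matrix n n ℂ)).inv_mem hu)).le⟩

/-- The gauge-transformed bond variable as a matrix: `W^{u_t}(b) = e^{tλ(x)} · W(b) · e^{−tλ(x+e_μ)}`. [folklore] -/
theorem val_gaugeAct_expGauge (W : Site d → Fin d → (Matrix n n ℂ)ˣ) (lam : Site d → Matrix n n ℂ) (t : ℝ)
    (x : Site d) (μ : Fin d) :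
    ((gaugeAct (expGauge lam t) W x μ : (Matrix n n ℂ)ˣ) : Matrix n n ℂ)
      = exp ((t : ℂ) • lam x) * ((W x μ : (Matrix n n ℂ)ˣ) : Matrix n n ℂ) * exp (-((t : ℂ) • lam (x + e μ))) := by
  simp [gaugeAct, expGauge]

/-- The relative unit `W(b)⁻¹·W^{u_t}(b)` has derivative `W(b)⁻¹(λ(x)W(b) − W(b)λ(x+e_μ))` at `t = 0`. [folklore] -/
theorem hasDerivAt_relUnit_gauge (W : Site d → Fin d → (Matrix n n ℂ)ˣ) (lam : Site d → Matrix n n ℂ)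
    (x : Site d) (μ : Fin d) :
    HasDerivAt (fun t : ℝ => (((W x μ)⁻¹ : (Matrix n n ℂ)ˣ) : Matrix n n ℂ)
        * ((gaugeAct (expGauge lam t) W x μ : (Matrix n n ℂ)ˣ) : Matrix n n ℂ))
      ((((W x μ)⁻¹ : (Matrix n n ℂ)ˣ) : Matrix n n ℂ)
        * (lam x * ((W x μ : (Matrix n n ℂ)ˣ) : Matrix n n ℂ) - ((W x μ : (Matrix n n ℂ)ˣ) : Matrix n n ℂ) * lam (x + e μ))) 0 := by
  have h1 := ((hasDerivAt_exp_smul_zero (lam x)).mul_const ((W x μ : (Matrix n n ℂ)ˣ) : Matrix n n ℂ)).mul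
    (hasDerivAt_exp_neg_smul_zero (lam (x + e μ)))
  have h2 := h1.const_mul ((((W x μ)⁻¹ : (Matrix n n ℂ)ˣ) : Matrix n n ℂ))
  simp only [val_gaugeAct_expGauge]
  refine h2.congr_deriv ?_
  simp only [Complex.ofReal_zero, zero_smul, neg_zero, exp_zero, one_mul, mul_one]
  noncomm_ring

/-- **THE POINTWISE DERIVATIVE OF THE RELATIVE LOGARITHM IS THE GAUGE DIRECTION**:
`d/dt|₀ log(W(b)⁻¹ W^{u_t}(b)) = gaugeDir W λ (b)`. [folklore] -/
theorem hasDerivAt_gaugeRelLog (W : Site d → Fin d → (Matrix n n ℂ)ˣ) (lam : Site d → Matrix n n ℂ) (x : Site d)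
    (μ : Fin d) : HasDerivAt (fun t : ℝ => gaugeRelLog W lam t x μ) (gaugeDir W lam x μ) 0 := by
  have hin := hasDerivAt_relUnit_gauge W lam x μ
  have h0 : (((W x μ)⁻¹ : (Matrix n n ℂ)ˣ) : Matrix n n ℂ) * ((gaugeAct (expGauge lam 0) W x μ : (Matrix n n ℂ)ˣ) : Matrix n n ℂ) = 1 := by
    rw [expGauge_zero, gaugeAct_const_one, Units.inv_mul]
  have hm := (hasFDerivAt_mlog_one (n := n)).restrictScalars ℝ
  rw [← h0] at hm
  have hc := hm.comp_hasDerivAt (0 : ℝ) hin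
  have hder : (ContinuousLinearMap.restrictScalars ℝ (ContinuousLinearMap.id ℂ (Matrix n n ℂ)))
      ((((W x μ)⁻¹ : (Matrix n n ℂ)ˣ) : Matrix n n ℂ)
        * (lam x * ((W x μ : (Matrix n n ℂ)ˣ) : Matrix n n ℂ) - ((W x μ : (Matrix n n ℂ)ˣ) : Matrix n n ℂ) * lam (x + e μ)))
      = gaugeDir W lam x μ := by
    simp only [ContinuousLinearMap.coe_restrictScalars', ContinuousLinearMap.id_apply, gaugeDir, Ad, inv_inv, mul_sub,
      ← mul_assoc, Units.inv_mul, one_mul]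
  rw [hder] at hc
  exact hc

/-- The same computation ONE LEVEL UP: for a unit `B` and matrices `λ₁, λ₂`,
`d/dt|₀ log(B⁻¹ · e^{tλ₁} B e^{−tλ₂}) = Ad_{B⁻¹}λ₁ − λ₂`. [folklore] -/
theorem hasDerivAt_mlog_conj_gauge (B : (Matrix n n ℂ)ˣ) (lam₁ lam₂ : Matrix n n ℂ) :
    HasDerivAt (fun t : ℝ => mlog (((B⁻¹ : (Matrix n n ℂ)ˣ) : Matrix n n ℂ)
        * (exp ((t : ℂ) • lam₁) * (B : Matrix n n ℂ) * exp (-((t : ℂ) • lam₂)))))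
      (Ad B⁻¹ lam₁ - lam₂) 0 := by
  have h1 := (((hasDerivAt_exp_smul_zero lam₁).mul_const (B : Matrix n n ℂ)).mul
    (hasDerivAt_exp_neg_smul_zero lam₂)).const_mul (((B⁻¹ : (Matrix n n ℂ)ˣ) : Matrix n n ℂ))
  have h0 : ((B⁻¹ : (Matrix n n ℂ)ˣ) : Matrix n n ℂ) * (exp (((0 : ℝ) : ℂ) • lam₁) * (B : Matrix n n ℂ) * exp (-(((0 : ℝ) : ℂ) • lam₂))) = 1 := by
    simp
  have hm := (hasFDerivAt_mlog_one (n := n)).restrictScalars ℝ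
  rw [← h0] at hm
  have hc := hm.comp_hasDerivAt (0 : ℝ) h1
  have hder : (ContinuousLinearMap.restrictScalars ℝ (ContinuousLinearMap.id ℂ (Matrix n n ℂ)))
      (((B⁻¹ : (Matrix n n ℂ)ˣ) : Matrix n n ℂ) * (lam₁ * (B : Matrix n n ℂ) * exp (-(((0 : ℝ) : ℂ) • lam₂))
        + exp (((0 : ℝ) : ℂ) • lam₁) * (B : Matrix n n ℂ) * -lam₂)) = Ad B⁻¹ lam₁ - lam₂ := by
    simp only [ContinuousLinearMap.coe_restrictScalars', ContinuousLinearMap.id_apply, Ad, inv_inv, Complex.ofReal_zero,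
      zero_smul, neg_zero, exp_zero, mul_one, one_mul, mul_add, mul_neg, ← mul_assoc, Units.inv_mul]
    abel
  rw [hder] at hc
  exact hc

/-! ## §2 Periodicity -/

/-- The gauge direction of periodic data is periodic. [folklore] -/
theorem isPeriodicDir_gaugeDir {W : Site d → Fin d → (Matrix n n ℂ)ˣ} {lam : Site d → Matrix n n ℂ} {P : ℤ}
    (hW : IsPeriodicCfg W P) (hlam : ∀ (x : Site d) (i : Fin d), lam (x + P • e i) = lam x) :
    IsPeriodicDir (gaugeDir W lam) P := by
  intro x i μ
  simp only [gaugeDir]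
  rw [hW x i μ, hlam x i, add_right_comm, hlam (x + e μ) i]

/-- The gauge-transformed configuration of periodic data is periodic. [folklore] -/
theorem isPeriodicCfg_gaugeAct_expGauge {W : Site d → Fin d → (Matrix n n ℂ)ˣ} {lam : Site d → Matrix n n ℂ} {P : ℤ}
    (hW : IsPeriodicCfg W P) (hlam : ∀ (x : Site d) (i : Fin d), lam (x + P • e i) = lam x) (t : ℝ) :
    IsPeriodicCfg (gaugeAct (expGauge lam t) W) P := by
  intro x i μ
  simp only [gaugeAct, expGauge]
  rw [hW x i μ, hlam x i, add_right_comm, hlam (x + e μ) i]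

/-- The relative logarithm of periodic data is periodic. [folklore] -/
theorem isPeriodicDir_gaugeRelLog {W : Site d → Fin d → (Matrix n n ℂ)ˣ} {lam : Site d → Matrix n n ℂ} {P : ℤ}
    (hW : IsPeriodicCfg W P) (hlam : ∀ (x : Site d) (i : Fin d), lam (x + P • e i) = lam x) (t : ℝ) :
    IsPeriodicDir (gaugeRelLog W lam t) P := by
  intro x i μ
  simp only [gaugeRelLog]
  rw [hW x i μ, isPeriodicCfg_gaugeAct_expGauge hW hlam t x i μ]

/-! ## §3 The covariance of the linearisation on the torus -/

section Torus

variable [Nonempty n]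

omit [Nonempty n] in
/-- Near `t = 0` every relative unit `W(b)⁻¹ W^{u_t}(b)` of PERIODIC data lies in the ball of (21) (finitely many values by
periodicity; continuity in `t`). [folklore] -/
theorem eventually_relUnit_gauge_ball {N : ℕ} [NeZero N] {W : Site d → Fin d → (Matrix n n ℂ)ˣ}
    {lam : Site d → Matrix n n ℂ} (hW : IsPeriodicCfg W (N : ℤ)) (hlam : ∀ (x : Site d) (i : Fin d), lam (x + (N : ℤ) • e i) = lam x) :
    ∀ᶠ t in 𝓝 (0 : ℝ), ∀ (x : Site d) (μ : Fin d),
      ‖(((W x μ)⁻¹ : (Matrix n n ℂ)ˣ) : Matrix n n ℂ) * ((gaugeAct (expGauge lam t) W x μ : (Matrix n n ℂ)ˣ) : Matrix n n ℂ) - 1‖ < 1 := by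
  -- finitely many representatives
  have hfin : ∀ᶠ t in 𝓝 (0 : ℝ), ∀ rμ : (Fin d → Fin N) × Fin d,
      ‖(((W (boxVec N rμ.1) rμ.2)⁻¹ : (Matrix n n ℂ)ˣ) : Matrix n n ℂ)
          * ((gaugeAct (expGauge lam t) W (boxVec N rμ.1) rμ.2 : (Matrix n n ℂ)ˣ) : Matrix n n ℂ) - 1‖ < 1 := by
    refine Filter.eventually_all.mpr fun rμ => ?_
    have hc : ContinuousAt (fun t : ℝ => ‖(((W (boxVec N rμ.1) rμ.2)⁻¹ : (Matrix n n ℂ)ˣ) : Matrix n n ℂ)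
        * ((gaugeAct (expGauge lam t) W (boxVec N rμ.1) rμ.2 : (Matrix n n ℂ)ˣ) : Matrix n n ℂ) - 1‖) 0 :=
      ((hasDerivAt_relUnit_gauge W lam (boxVec N rμ.1) rμ.2).continuousAt.sub continuousAt_const).norm
    have h0 : ‖(((W (boxVec N rμ.1) rμ.2)⁻¹ : (Matrix n n ℂ)ˣ) : Matrix n n ℂ)
        * ((gaugeAct (expGauge lam 0) W (boxVec N rμ.1) rμ.2 : (Matrix n n ℂ)ˣ) : Matrix n n ℂ) - 1‖ < 1 := by
      rw [expGauge_zero, gaugeAct_const_one, Units.inv_mul, sub_self, norm_zero]; exact one_pos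
    exact hc.eventually (gt_mem_nhds h0)
  refine hfin.mono fun t ht x μ => ?_
  -- reduce `x` to its representative
  set f : Site d → Matrix n n ℂ := fun z =>
    (((W z μ)⁻¹ : (Matrix n n ℂ)ˣ) : Matrix n n ℂ) * ((gaugeAct (expGauge lam t) W z μ : (Matrix n n ℂ)ˣ) : Matrix n n ℂ) with hf
  have hper : ∀ (z : Site d) (i : Fin d), f (z + (N : ℤ) • e i) = f z := by
    intro z i
    simp only [hf]
    rw [hW z i μ, isPeriodicCfg_gaugeAct_expGauge hW hlam t z i μ]
  have hx := eq_wrap_add N x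
  have key := periodic_smul_vec hper (boxVec N (redN N x)) (fun i => x i / (N : ℤ))
  rw [← hx] at key
  show ‖f x - 1‖ < 1
  rw [key]
  exact ht (redN N x, μ)

omit [Nonempty n] in
/-- Near `t = 0` the gauge-transformed configuration IS the chart point of its relative logarithm:
`chart id N W (resDir N (gaugeRelLog W λ t)) = W^{u_t}`. [folklore] -/
theorem eventually_chart_gaugeRelLog {N : ℕ} [NeZero N] {W : Site d → Fin d → (Matrix n n ℂ)ˣ}
    {lam : Site d → Matrix n n ℂ} (hW : IsPeriodicCfg W (N : ℤ)) (hlam : ∀ (x : Site d) (i : Fin d), lam (x + (N : ℤ) • e i) = lam x) :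
    ∀ᶠ t in 𝓝 (0 : ℝ),
      chart (ContinuousLinearMap.id ℝ (Matrix n n ℂ)) N W (resDir N (gaugeRelLog W lam t)) = gaugeAct (expGauge lam t) W := by
  refine (eventually_relUnit_gauge_ball hW hlam).mono fun t ht => ?_
  rw [chart_eq_vary_one, chartDir_id_resDir N (isPeriodicDir_gaugeRelLog hW hlam t)]
  funext x μ
  apply Units.ext
  simp only [vary, Units.val_mul, val_expUnit, Complex.ofReal_one, one_smul, gaugeRelLog]
  rw [exp_mlog (ht x μ), ← mul_assoc, Units.mul_inv, one_mul]

/-- **THE LINEARISATION OF THE AVERAGE IS GAUGE-COVARIANT.**  For a `U(N)`-valued `LM`-periodic `W` in the small-field class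
(`SmallField W a`, `512(d+1)(d+4)L²a ≤ 1`) and an `LM`-periodic `𝔲(N)`-valued site field `λ`, at every torus representative
`q = boxVec M r`:
`pushDir L W (gaugeDir W λ) (L·q, κ) = Ad_{(cavg L W)(q,κ)⁻¹} λ(L·q) − λ(L·q + L·e_κ)` (= `gaugeDir (cavg L W) (λ ∘ (L·)) (q, κ)`).
The derivative of (45) (`bavg_gaugeAct`) along `u_t = e^{tλ}`, through the chain rule for `coord` (`fderiv_coord_apply`).
[cite: Balaban1985Averaging, (45) p.24] -/
theorem pushDir_gaugeDir {L M : ℕ} [NeZero (L * M)] (hL : 1 ≤ L) {W : Site d → Fin d → (Matrix n n ℂ)ˣ}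
    (hWu : IsUnitaryCfg W) (hWP : IsPeriodicCfg W ((L * M : ℕ) : ℤ)) {a : ℝ} (ha : 0 ≤ a)
    (hsmall : 512 * (d + 1) * (d + 4) * (L : ℝ) ^ 2 * a ≤ 1) (hWa : SmallField W a)
    {lam : Site d → Matrix n n ℂ} (hlam : ∀ x, lam x ∈ skewAdjoint (Matrix n n ℂ))
    (hlamP : ∀ (x : Site d) (i : Fin d), lam (x + ((L * M : ℕ) : ℤ) • e i) = lam x)
    (r : Fin d → Fin M) (κ : Fin d) :
    pushDir L W (gaugeDir W lam) ((L : ℤ) • boxVec M r) κ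
      = Ad (cavg L W (boxVec M r) κ)⁻¹ (lam ((L : ℤ) • boxVec M r)) - lam ((L : ℤ) • boxVec M r + (L : ℤ) • e κ) := by
  have hball : ∀ (q : Site d) (κ : Fin d) (r : Fin d → Fin L), ‖((Wcx L W q κ (boxVec L r) : (Matrix n n ℂ)ˣ) : Matrix n n ℂ) - 1‖ < 1 :=
    norm_Wcx_sub_one_lt_one_of_smallField L hL hWu ha hsmall hWa
  -- the curve in the chart parameter space and its velocity
  set ψ : ℝ → TDir d n (L * M) := fun t => resDir (L * M) (gaugeRelLog W lam t) with hψdef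
  have hψ0 : ψ 0 = 0 := by
    funext r' κ'; simp [hψdef, resDir]
  have hψ' : HasDerivAt ψ (resDir (L * M) (gaugeDir W lam)) 0 := by
    rw [hasDerivAt_pi]
    intro r'
    rw [hasDerivAt_pi]
    intro κ'
    exact hasDerivAt_gaugeRelLog W lam (boxVec (L * M) r') κ'
  -- the chain rule through `coord`
  have hF : HasFDerivAt (coord (ContinuousLinearMap.id ℝ (Matrix n n ℂ)) L M W)
      (fderiv ℝ (coord (ContinuousLinearMap.id ℝ (Matrix n n ℂ)) L M W) 0) (ψ 0) := by
    rw [hψ0]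
    exact ((contDiffAt_coord (m := 1) (ContinuousLinearMap.id ℝ (Matrix n n ℂ)) L M W hball).differentiableAt
      one_ne_zero).hasFDerivAt
  have hchain := hF.comp_hasDerivAt (0 : ℝ) hψ'
  have h1 : HasDerivAt (fun t : ℝ => coord (ContinuousLinearMap.id ℝ (Matrix n n ℂ)) L M W (ψ t) r κ)
      (pushDir L W (gaugeDir W lam) ((L : ℤ) • boxVec M r) κ) 0 := by
    have h := hasDerivAt_pi.mp (hasDerivAt_pi.mp hchain r) κ
    rw [fderiv_coord_apply (ContinuousLinearMap.id ℝ (Matrix n n ℂ)) L M W hball,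
      chartDir_id_resDir (L * M) (isPeriodicDir_gaugeDir hWP hlamP)] at h
    exact h
  -- the same function through (45)
  have hU : ∀ (t : ℝ) (x : Site d), expGauge lam t x ∈ U1 (Matrix n n ℂ) := fun t x => expGauge_mem_U1 hlam t x
  set q : Site d := (L : ℤ) • boxVec M r with hq
  have h2 : HasDerivAt (fun t : ℝ => coord (ContinuousLinearMap.id ℝ (Matrix n n ℂ)) L M W (ψ t) r κ)
      (Ad (cavg L W (boxVec M r) κ)⁻¹ (lam q) - lam (q + (L : ℤ) • e κ)) 0 := by
    have hev := eventually_chart_gaugeRelLog (N := L * M) hWP hlamP (lam := lam)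
    refine (hasDerivAt_mlog_conj_gauge (cavg L W (boxVec M r) κ) (lam q) (lam (q + (L : ℤ) • e κ))).congr_of_eventuallyEq ?_
    refine hev.mono fun t ht => ?_
    simp only [coord, relLog, hψdef]
    rw [ht]
    simp only [cavg, ← hq]
    rw [bavg_gaugeAct L (hU t) W q κ (hball q κ)]
    simp only [Units.val_mul, expGauge, val_expUnit, val_inv_expUnit]
  rw [hq] at h2
  exact h1.unique h2

/-- The same identity read as `P_W ∘ G_W = G_{W̄} ∘ (restriction to the coarse sites)`:
`pushDir L W (gaugeDir W λ) (L·q, κ) = gaugeDir (cavg L W) (λ ∘ (L·)) (q, κ)`. [folklore] -/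
theorem pushDir_gaugeDir_eq_gaugeDir_cavg {L M : ℕ} [NeZero (L * M)] (hL : 1 ≤ L) {W : Site d → Fin d → (Matrix n n ℂ)ˣ}
    (hWu : IsUnitaryCfg W) (hWP : IsPeriodicCfg W ((L * M : ℕ) : ℤ)) {a : ℝ} (ha : 0 ≤ a)
    (hsmall : 512 * (d + 1) * (d + 4) * (L : ℝ) ^ 2 * a ≤ 1) (hWa : SmallField W a)
    {lam : Site d → Matrix n n ℂ} (hlam : ∀ x, lam x ∈ skewAdjoint (Matrix n n ℂ))
    (hlamP : ∀ (x : Site d) (i : Fin d), lam (x + ((L * M : ℕ) : ℤ) • e i) = lam x)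
    (r : Fin d → Fin M) (κ : Fin d) :
    pushDir L W (gaugeDir W lam) ((L : ℤ) • boxVec M r) κ
      = gaugeDir (cavg L W) (fun y => lam ((L : ℤ) • y)) (boxVec M r) κ := by
  rw [pushDir_gaugeDir hL hWu hWP ha hsmall hWa hlam hlamP r κ]
  simp only [gaugeDir, smul_add]

end Torus

end

end Summit.QuantumFields.BalabanUV.T4Continuum.BlockAveragePushDirGauge
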